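import Mathlib
import HarnessLib
import Summits.ABC.ABC.Theses.ParitySliceConcordantNorms
import Literature.NumberTheory.DiophantineGeometry.PastenSubexpTheorem14
import Summits.ABC.ABC.Theorems.IneffectiveSubspaceDepthCountedABCStubAssembly
import Summits.ABC.ABC.Theorems.SparseGoodScales.Negative.ExactZero

/-!
# `ParitySliceConcordantNorms` Assembly, part 1/3 — squares, odd exponents, the generic breeding step

Elementary arithmetic for the proof of the route Assembly `NonSquareTopABC → SquareTopResidualFinite → ABC`
(route-ABC-parity-slice-concordant-norms, item `stmt-ABC-4016`; main file
`Theorems/ParitySliceConcordantNormsAssembly.lean`, which carries the full account): parity of `p`-adic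
exponents vs. squares, non-squareness of a quotient `C / g` read off one prime `p ∤ g` of odd exponent, the
reduction `(A, B) ↦ (A/g, B/g, (A+B)/g)` to an abc-triple with its radical bound, and the generic packaging
`breed_generic` of a breeding identity `A + B = C` into a non-square-top abc-triple of controlled size and radical.
Reused tree lemmas (gate dedup): `rad_swap` (PastenSubexpTheorem14), `DepthCountedABC.isABCTriple_swap`,
`SparseGoodScales.Negative.not_dvd_of_coprime`.
Unconditional; standard axioms; no named facts; no `def`s.  (Crux strategist `planner-cstrat-stmt-ABC-4010-r1-0`.)
-/

-- `Summit.<Summit>.<Problem>`: for the single-conjunct summit `ABC` the duplicate `ABC.ABC` is mandated.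
set_option linter.dupNamespace false

namespace Summit.ABC.ABC.Theorems.ParitySliceAssembly

open Literature.NumberTheory.DiophantineGeometry
open Summit.ABC.ABC.Theses.ParitySliceConcordantNorms
open UniqueFactorizationMonoid

/-! ## §1 Squares and odd exponents -/

/-- A square has even exponents at every prime. -/
theorem even_factorization_of_isSquare {n : ℕ} (hn : n ≠ 0) (h : IsSquare n) (p : ℕ) :
    Even (n.factorization p) := by
  obtain ⟨r, rfl⟩ := h
  have hr : r ≠ 0 := by rintro rfl; simp at hn
  rw [Nat.factorization_mul hr hr, Finsupp.add_apply]
  exact ⟨_, rfl⟩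

/-- A non-square has a prime with odd exponent. -/
theorem exists_odd_factorization_of_not_isSquare {n : ℕ} (hn : n ≠ 0) (h : ¬ IsSquare n) :
    ∃ p : ℕ, p.Prime ∧ Odd (n.factorization p) := by
  obtain ⟨t, s, ht, hs, hst, hsf⟩ := Nat.sq_mul_squarefree_of_pos (Nat.pos_of_ne_zero hn)
  have ht1 : t ≠ 1 := by
    rintro rfl
    exact h ⟨s, by rw [← hst]; ring⟩
  obtain ⟨p, hp, hpt⟩ := Nat.exists_prime_and_dvd ht1
  refine ⟨p, hp, ?_⟩
  have htf : t.factorization p = 1 := by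
    have hle := (Nat.squarefree_iff_factorization_le_one ht.ne').mp hsf p
    have hpos := hp.factorization_pos_of_dvd ht.ne' hpt
    omega
  rw [← hst, Nat.factorization_mul (pow_ne_zero 2 hs.ne') ht.ne', Nat.factorization_pow,
    Finsupp.add_apply, Finsupp.smul_apply, smul_eq_mul, htf]
  exact ⟨s.factorization p, rfl⟩

/-- If `n` is neither a square nor three times a square, some prime `p ≠ 3` has odd exponent in `n`. -/
theorem exists_odd_factorization_ne_three {n : ℕ} (hn : n ≠ 0) (h1 : ¬ IsSquare n)
    (h3 : ¬ IsSquare (3 * n)) : ∃ p : ℕ, p.Prime ∧ p ≠ 3 ∧ Odd (n.factorization p) := by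
  obtain ⟨p, hp, hodd⟩ := exists_odd_factorization_of_not_isSquare hn h1
  by_cases hp3 : p = 3
  · subst hp3
    obtain ⟨q, hq, hqodd⟩ := exists_odd_factorization_of_not_isSquare (by positivity) h3
    have h3n : (3 * n).factorization = (3 : ℕ).factorization + n.factorization :=
      Nat.factorization_mul (by norm_num) hn
    by_cases hq3 : q = 3
    · subst hq3
      rw [h3n, Finsupp.add_apply, Nat.Prime.factorization_self Nat.prime_three] at hqodd
      obtain ⟨k, hk⟩ := hodd
      obtain ⟨k', hk'⟩ := hqodd
      omega
    · refine ⟨q, hq, hq3, ?_⟩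
      have hq3d : ¬ q ∣ 3 := fun hd =>
        hq3 ((Nat.prime_dvd_prime_iff_eq hq Nat.prime_three).mp hd)
      rwa [h3n, Finsupp.add_apply, Nat.factorization_eq_zero_of_not_dvd hq3d, zero_add] at hqodd
  · exact ⟨p, hp, hp3, hodd⟩

/-- Non-squareness of a quotient: if `g ∣ C`, `p ∤ g` and `v_p(C)` is odd then `C / g` is not a square. -/
theorem not_isSquare_div {C g p : ℕ} (hC : C ≠ 0) (hg : g ∣ C) (hpg : ¬ p ∣ g)
    (hodd : Odd (C.factorization p)) : ¬ IsSquare (C / g) := by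
  intro hsq
  have hg0 : g ≠ 0 := by
    rintro rfl
    exact hC (zero_dvd_iff.mp hg)
  have hq0 : C / g ≠ 0 :=
    (Nat.div_pos (Nat.le_of_dvd (Nat.pos_of_ne_zero hC) hg) (Nat.pos_of_ne_zero hg0)).ne'
  have heven := even_factorization_of_isSquare hq0 hsq p
  have hfac : C.factorization p = g.factorization p + (C / g).factorization p := by
    conv_lhs => rw [← Nat.mul_div_cancel' hg]
    rw [Nat.factorization_mul hg0 hq0, Finsupp.add_apply]
  rw [Nat.factorization_eq_zero_of_not_dvd hpg, zero_add] at hfac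
  rw [hfac] at hodd
  exact (Nat.not_even_iff_odd.mpr hodd) heven
  
/-- An odd exponent forces divisibility. -/
theorem dvd_of_odd_factorization {n p : ℕ} (h : Odd (n.factorization p)) : p ∣ n :=
  Nat.dvd_of_factorization_pos (Nat.pos_of_ne_zero (fun h0 => by simp [h0] at h)).ne'

/-! ## §2 The generic breeding step `(A, B) ↦ (A/g, B/g, (A+B)/g)` -/

/-- Reducing a positive pair by its gcd gives an abc-triple. -/
theorem isABCTriple_div_gcd {A B : ℕ} (hA : 0 < A) (hB : 0 < B) :
    IsABCTriple (A / Nat.gcd A B) (B / Nat.gcd A B) ((A + B) / Nat.gcd A B) := by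
  have hg : 0 < Nat.gcd A B := Nat.gcd_pos_of_pos_left B hA
  refine ⟨Nat.div_pos (Nat.le_of_dvd hA (Nat.gcd_dvd_left A B)) hg,
    Nat.div_pos (Nat.le_of_dvd hB (Nat.gcd_dvd_right A B)) hg, ?_,
    Nat.coprime_div_gcd_div_gcd hg⟩
  exact (Nat.add_div_of_dvd_right (Nat.gcd_dvd_left A B)).symm

/-- The radical of the reduced triple divides the radical of `A * B * (A + B)`. -/
theorem rad_div_gcd_le {A B : ℕ} (hA : 0 < A) (hB : 0 < B) :
    rad (A / Nat.gcd A B) (B / Nat.gcd A B) ((A + B) / Nat.gcd A B) ≤ radical (A * B * (A + B)) := by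
  rw [rad_def]
  refine Nat.le_of_dvd (Nat.radical_pos _) (radical_dvd_radical ?_ (by positivity))
  exact Nat.mul_dvd_mul (Nat.mul_dvd_mul (Nat.div_dvd_of_dvd (Nat.gcd_dvd_left A B))
    (Nat.div_dvd_of_dvd (Nat.gcd_dvd_right A B)))
    (Nat.div_dvd_of_dvd (dvd_add (Nat.gcd_dvd_left A B) (Nat.gcd_dvd_right A B)))

/-- Radical of a product is at most the product of radicals (as naturals). -/
theorem radical_mul_le (x y : ℕ) : radical (x * y) ≤ radical x * radical y :=
  Nat.le_of_dvd (Nat.mul_pos (Nat.radical_pos _) (Nat.radical_pos _)) radical_mul_dvd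

/-- `radical n ≤ n` for `n ≠ 0`. -/
theorem radical_le_self' {n : ℕ} (hn : n ≠ 0) : radical n ≤ n :=
  Nat.le_of_dvd (Nat.pos_of_ne_zero hn) radical_dvd_self

/-- `radical (n ^ k) ≤ n` for `n ≠ 0`. -/
theorem radical_pow_le {n : ℕ} (hn : n ≠ 0) (k : ℕ) : radical (n ^ k) ≤ n := by
  rcases Nat.eq_zero_or_pos k with rfl | hk
  · simp only [pow_zero, radical_one]
    exact Nat.pos_of_ne_zero hn
  · rw [radical_pow n hk.ne']
    exact radical_le_self' hn

/-- The `abc`-part of a bred triple: `radical (a^i * b^j * c^k) ≤ rad a b c`. -/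
theorem radical_monomial_le {a b c : ℕ} (ha : 0 < a) (hb : 0 < b) (hc : 0 < c) (i j k : ℕ)
    (hi : i ≤ 3) (hj : j ≤ 3) (hk : k ≤ 3) :
    radical (a ^ i * b ^ j * c ^ k) ≤ rad a b c := by
  rw [rad_def]
  have h3 : radical ((a * b * c) ^ 3) = radical (a * b * c) := radical_pow _ (by norm_num)
  rw [← h3]
  refine Nat.le_of_dvd (Nat.radical_pos _) (radical_dvd_radical ?_ (by positivity))
  calc a ^ i * b ^ j * c ^ k ∣ a ^ 3 * b ^ 3 * c ^ 3 :=
        Nat.mul_dvd_mul (Nat.mul_dvd_mul (Nat.pow_dvd_pow a hi) (Nat.pow_dvd_pow b hj))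
          (Nat.pow_dvd_pow c hk)
    _ = (a * b * c) ^ 3 := by ring

/-! ## §3 Generic packaging of a breeding -/

/-- Radical bound for a bred product `(a^i b^j c^k) · (X^m · Y)`. -/
theorem radical_bred_le {a b c i j k X m Y : ℕ} (ha : 0 < a) (hb : 0 < b) (hc : 0 < c)
    (hi : i ≤ 3) (hj : j ≤ 3) (hk : k ≤ 3) (hX : X ≠ 0) (hY : Y ≠ 0) :
    radical ((a ^ i * b ^ j * c ^ k) * (X ^ m * Y)) ≤ rad a b c * (X * Y) := by
  calc radical ((a ^ i * b ^ j * c ^ k) * (X ^ m * Y))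
        ≤ radical (a ^ i * b ^ j * c ^ k) * radical (X ^ m * Y) := radical_mul_le _ _
    _ ≤ rad a b c * (radical (X ^ m) * radical Y) :=
        Nat.mul_le_mul (radical_monomial_le ha hb hc i j k hi hj hk) (radical_mul_le _ _)
    _ ≤ rad a b c * (X * Y) :=
        Nat.mul_le_mul_left _ (Nat.mul_le_mul (radical_pow_le hX m) (radical_le_self' hY))

/-- **Generic breeding.** From positive `A + B = C`, a prime-free witness `p ∤ A` with `v_p(C)` odd,
a bound `gcd(A,B) ∣ κ`, a size bound and a radical bound, the reduced triple
`(A/g, B/g, C/g)` is a non-square-top abc-triple of the required size and radical. -/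
theorem breed_generic {a b c A B C d p κ : ℕ} (hA : 0 < A) (hB : 0 < B) (hid : A + B = C)
    (hpA : ¬ p ∣ A) (hodd : Odd (C.factorization p))
    (hgk : Nat.gcd A B ∣ κ) (hκ : 0 < κ) (hsize : κ * c ^ d ≤ 81 * C)
    (hrad : radical (A * B * C) ≤ 24 * c ^ (d - 1) * rad a b c) :
    ∃ A' B' C' : ℕ, IsABCTriple A' B' C' ∧ ¬ IsSquare C' ∧ c ^ d ≤ 81 * C' ∧
      rad A' B' C' ≤ 24 * c ^ (d - 1) * rad a b c := by
  have hC : 0 < C := by omega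
  have hg0 : 0 < Nat.gcd A B := Nat.gcd_pos_of_pos_left B hA
  have hgA : Nat.gcd A B ∣ A := Nat.gcd_dvd_left A B
  have hgB : Nat.gcd A B ∣ B := Nat.gcd_dvd_right A B
  have hgC : Nat.gcd A B ∣ C := hid ▸ dvd_add hgA hgB
  refine ⟨A / Nat.gcd A B, B / Nat.gcd A B, C / Nat.gcd A B, ?_, ?_, ?_, ?_⟩
  · rw [← hid]; exact isABCTriple_div_gcd hA hB
  · exact not_isSquare_div hC.ne' hgC (fun h => hpA (h.trans hgA)) hodd
  · -- size: κ c^d ≤ 81 C = 81 g (C/g) ≤ 81 κ (C/g)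
    have hgle : Nat.gcd A B ≤ κ := Nat.le_of_dvd hκ hgk
    have h1 : κ * c ^ d ≤ κ * (81 * (C / Nat.gcd A B)) := by
      calc κ * c ^ d ≤ 81 * C := hsize
        _ = 81 * (Nat.gcd A B * (C / Nat.gcd A B)) := by rw [Nat.mul_div_cancel' hgC]
        _ ≤ 81 * (κ * (C / Nat.gcd A B)) := Nat.mul_le_mul_left _ (Nat.mul_le_mul_right _ hgle)
        _ = κ * (81 * (C / Nat.gcd A B)) := by ring
    exact Nat.le_of_mul_le_mul_left h1 hκ
  · rw [← hid]
    calc rad (A / Nat.gcd A B) (B / Nat.gcd A B) ((A + B) / Nat.gcd A B)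
          ≤ radical (A * B * (A + B)) := rad_div_gcd_le hA hB
      _ ≤ 24 * c ^ (d - 1) * rad a b c := hid ▸ hrad

end Summit.ABC.ABC.Theorems.ParitySliceAssembly
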